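import Summits.RiemannHypothesis.RiemannHypothesis.Theorems.WeilFormatCDataO94FrontData
import Summits.RiemannHypothesis.RiemannHypothesis.Theorems.S2FormatCE0
import Literature.NumberTheory.LFunctions.YoshidaWindowGramTailMSSines
import Literature.NumberTheory.LFunctions.YoshidaWindowGramMiddleJBox
import Literature.NumberTheory.LFunctions.YoshidaWindowGramTailJFactoredScaled
import Literature.NumberTheory.LFunctions.YoshidaWindowGramTailMSFactored
import Literature.NumberTheory.LFunctions.YoshidaWindowGramTailJDiagTight
import Summits.RiemannHypothesis.RiemannHypothesis.Theorems.FormatCPsdBands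
import Summits.RiemannHypothesis.RiemannHypothesis.Theorems.WeilFormatCDiagShift
import HarnessLib

/-!
# Format C kernel rung `O94` (a = 47/50, column-band layout): odd sector: certified digits of the ψ tail factors, rows below 64 (kernel certificates)

Window `a = 47/50`; prime powers in the window: 2, 3, 2^2, 5; prime constant A = 1825/1000 (`WeilFormatC.primeCoeff_form_ge_cells_09729`); evaluator parameters S = 2^256, Kpi 130, Kser 150, kred 8, Kexp 45, J 120; full table modes < 161; light column table modes < 1027; units 2^-250 (Schur entries), 2^-124 (column digits, width 127), 2^-118 (tail-factor digits, width 121), 2^-64 (reciprocal weights), 2^-40 (tail base); order-J tail J = 4, θ = 1/2048, η = 1/10 | 4/1.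
Design row: sr-gb-rung-a odd λ-run (parity cell 10 L-side): a = 47/50, μ = 2^-75, odd 160/320/1024, MS tail; see HOME(A)/LADDER-LSIDES-FORMATC-A-g22.md. Generated by sr-gb-rung-a prover A g22 with rh-explicit-weil-2 gen7's generator extended for the odd λ-run (--sector odd --mu-log2; HOME(A)/code-g22/gen7/gramgen7.py sha16 172ee47dc0b1c923) from `#eval` of the tree's `Encl` functions; every datum is re-verified by the kernel in the theorem files (`decide +kernel`). Helper data of the rh-explicit Weil-positivity programme (format C, K-CELL-2), RH-free. [cite: Yoshida1992HermitianForms, §5 (5.15)-(5.16) p. 301; §7 pp. 305–312]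
-/

set_option linter.dupNamespace false
set_option maxRecDepth 200000

namespace Summit.RiemannHypothesis.RiemannHypothesis.Theorems.WeilFormatCData.O94CBOdd
open Literature.NumberTheory.LFunctions Literature.NumberTheory.LFunctions.Yoshida1992 Encl Literature.Analysis.ValidatedNumerics.NumericsMP
open Summit.RiemannHypothesis.RiemannHypothesis.Theorems.WeilFormatCData.O94

/-- kernel: ψ-digits rows `[0, 32)`. -/
theorem tPsi0 : checkRect (2 ^ 256) 118 (O94CBOdd.ρψ : ℤ) 121 8 (2 ^ (121 - 1)) (fun i r ↦ (psiMidOSBox (2 ^ 256) O94.C O94.F (tget O94.tab (i + 1)) 1 1024 160 4 O94.momO i r).add (psiMSoSBox (2 ^ 256) O94.C O94.F O94.ks (tget O94.tab (i + 1)) 40 1563711840992 160 1024 4 1 2048 4 1 O94.csd O94.sd1 O94.sdm O94.sdp i r)) O94CBOdd.ΨP 0 32 0 8 = true := by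
  decide +kernel

/-- kernel: ψ-digits rows `[32, 64)`. -/
theorem tPsi32 : checkRect (2 ^ 256) 118 (O94CBOdd.ρψ : ℤ) 121 8 (2 ^ (121 - 1)) (fun i r ↦ (psiMidOSBox (2 ^ 256) O94.C O94.F (tget O94.tab (i + 1)) 1 1024 160 4 O94.momO i r).add (psiMSoSBox (2 ^ 256) O94.C O94.F O94.ks (tget O94.tab (i + 1)) 40 1563711840992 160 1024 4 1 2048 4 1 O94.csd O94.sd1 O94.sdm O94.sdp i r)) O94CBOdd.ΨP 32 32 0 8 = true := by
  decide +kernel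

end Summit.RiemannHypothesis.RiemannHypothesis.Theorems.WeilFormatCData.O94CBOdd
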